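import Summits.QuantumFields.BalabanUV.T4Continuum.Support.RegionStarLineGauge

/-!
# `BalabanUV.T4Continuum.Support.RegionCollarFold` — NE2 (node U1a) formalisation swarm, SUPPLIER item «Δ1-VEC-W1-HOLED» under the
# owner's sub-row `T4-U1a.S-NE2-D1-DIRICHLET°` (vector layer W1), file 1/3: THE `3^d`-BLOCK COLLAR OF A UNIT BLOCK `w` IN THE DIGIT
# CHART AND THE FOLD `F : collar → w` (even reflection across every face of `w`) «not in print; our construction»
# (unit b2b-balaban-t4-ne2-formalise-leaf-09, gen 9, v1)

HONEST FRAMING (T4-DAG p. 1).  [folklore] lattice bookkeeping only — no operator, no estimate of the programme: the collar blocks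
`(cblk k)_ν = w_ν − 1 + k_ν` (`k ∈ {0,1,2}^d`; they are `3^d` DISTINCT blocks when `3 ≤ M_ν`), the collar sites `csite k j = bpt (cblk k) j`,
the offset chart `koff x ν = ((blockOf x)_ν − (w_ν − 1)).val` (so `koff (csite k j) = k`, and the `Finset` `collar` of the sites with
`koff x < 3` coordinatewise is exactly the image of the chart), the FOLD `F x = bpt w (j_μ if koff_μ = 1, rev j_μ otherwise)` (`F = id` on `w`), and what a unit step does to `koff`,
to the digits and to `F` (inside a collar block the `F`-images are equal-or-adjacent in `w`; across the two reflection interfaces of each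
direction `F` does not move; leaving the collar sends the `ρ`-offset outside `{1,2}` with digit `0`).  This is the geometric half of the
torus-gauge transfer of W1 to the complement of a block (`RegionCollarCutoff`, `RegionGaugeHoled`).  Nothing printed is a hypothesis;
NE2 (U1a) NOT proved; spine PROVED 0/9 unchanged; NOT [B9] (3.23)–(3.27) as printed; NOT infinite volume, NOT the mass gap, NOT Clay.
HONEST DEPENDENCY (verbatim): «continuum YM on T⁴ ⇐ BetaPertH ∧ nine spine estimates (0/9 proved); BetaPertH ⇐ (D1) ∧ (D4) ∧ CAP+tail;
G-an2-4 gates asym, D1 and NE2/3/4.»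

ABSOLUTE RULE (cell, verbatim): «No internally-minted statement may enter as a cited fact. Every hypothesis is either kernel-proved in
this package or a verbatim quotation of a PUBLISHED theorem with page reference. The manuscript(s) under audit are NOT citable for
their own disputed steps — they are the thing under adjudication; programme-internal (2001/route/tribunal) claims are never citable.»
[folklore] throughout; data defs `cblk`, `csite`, `koff`, `foldD`, `fold`; no `def … : Prop` (the collar is a `Finset` of sites).  NOT CLAIMED: anything analytic; NE2; NE3.
-/

noncomputable section

open scoped BigOperators ComplexConjugate Matrix
open Finset

namespace Summit.QuantumFields.BalabanUV.T4Continuum.RegionCollarFold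

open Literature.MathematicalPhysics.QuantumFieldTheory.Balaban1983to89.B5Prop11Plancherel (Tor fine unitVec)
open Literature.MathematicalPhysics.QuantumFieldTheory.Balaban1983to89.B5Block118 (bpt)
open Literature.MathematicalPhysics.QuantumFieldTheory.Balaban1983to89.B5Blocks16 (blockOf blockOf_bpt bpt_injective)
open Summit.QuantumFields.BalabanUV.T4Continuum
open Summit.QuantumFields.BalabanUV.T4Continuum.ScalarBlockTrialFunction (digits digits_bpt bpt_add_unitVec_of_lt bpt_add_unitVec_of_eq)
open Summit.QuantumFields.BalabanUV.T4Continuum.RegionGaugeFixedVectorFlat (bpt_blockOf_digits blockOf_add_unitVec)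

variable {d : ℕ} (n : ℕ) [NeZero n] (M : Fin d → ℕ) [hM : ∀ μ, NeZero (M μ)] (w : Tor M)

/-! ## §1 The collar chart -/

/-- the collar block with offset `k ∈ {0,1,2}^d`: `(cblk k)_ν = w_ν − 1 + k_ν` (`k = 1` is `w` itself). [folklore] -/
def cblk (k : Fin d → Fin 3) : Tor M := fun ν => w ν - 1 + ((k ν : ℕ) : ZMod (M ν))

/-- the collar site with offset `k` and digits `j`. [folklore] -/
def csite (k : Fin d → Fin 3) (j : Fin d → Fin n) : Tor (fine n M) := bpt n M (cblk M w k) j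

/-- the offset chart: `koff x ν = ((blockOf x)_ν − (w_ν − 1)).val ∈ {0, …, M_ν − 1}`. [folklore] -/
def koff (x : Tor (fine n M)) (ν : Fin d) : ℕ := ((blockOf n M x) ν - (w ν - 1)).val

/-- **THE COLLAR** as a finite set of fine sites: every offset is `< 3`. [folklore] -/
def collar : Finset (Tor (fine n M)) := univ.filter fun x => ∀ ν, koff n M w x ν < 3

/-- membership in the collar. [folklore] -/
@[simp] theorem mem_collar {x : Tor (fine n M)} : x ∈ collar n M w ↔ ∀ ν, koff n M w x ν < 3 := by
  simp [collar]

omit hM in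
/-- `cblk 1 = w`. [folklore] -/
theorem cblk_one : cblk M w (fun _ => 1) = w := by
  funext ν; simp [cblk]

/-- the offsets of a collar site are its `k` (`3 ≤ M_ν`). [folklore] -/
theorem koff_csite (hM3 : ∀ μ, 3 ≤ M μ) (k : Fin d → Fin 3) (j : Fin d → Fin n) (ν : Fin d) :
    koff n M w (csite n M w k j) ν = k ν := by
  rw [koff, csite, blockOf_bpt]
  simp only [cblk]
  rw [add_sub_cancel_left, ZMod.val_natCast, Nat.mod_eq_of_lt (lt_of_lt_of_le (k ν).isLt (hM3 ν))]

/-- the digits of a collar site are its `j`. [folklore] -/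
theorem digits_csite (k : Fin d → Fin 3) (j : Fin d → Fin n) : digits n M (csite n M w k j) = j :=
  digits_bpt n M _ j

/-- collar sites are in the collar. [folklore] -/
theorem csite_mem_collar (hM3 : ∀ μ, 3 ≤ M μ) (k : Fin d → Fin 3) (j : Fin d → Fin n) : csite n M w k j ∈ collar n M w :=
  (mem_collar n M w).2 fun ν => by rw [koff_csite n M w hM3]; exact (k ν).isLt

/-- on the block `w` every offset is `1` (`2 ≤ M_ν`). [folklore] -/
theorem koff_of_blockOf_eq (hM2 : ∀ μ, 2 ≤ M μ) {x : Tor (fine n M)} (hx : blockOf n M x = w) (ν : Fin d) : koff n M w x ν = 1 := by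
  rw [koff, hx, sub_sub_cancel]
  haveI : Fact (1 < M ν) := ⟨hM2 ν⟩
  exact ZMod.val_one _

/-- the offset vector of a collar site as an element of `{0,1,2}^d`. [folklore] -/
def kfin (x : Tor (fine n M)) (hx : x ∈ collar n M w) : Fin d → Fin 3 := fun ν => ⟨koff n M w x ν, (mem_collar n M w).1 hx ν⟩

/-- **THE CHART IS ONTO THE COLLAR**: a collar site is `csite (koff x) (digits x)`. [folklore] -/
theorem csite_kfin (x : Tor (fine n M)) (hx : x ∈ collar n M w) : csite n M w (kfin n M w x hx) (digits n M x) = x := by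
  rw [csite]
  conv_rhs => rw [← bpt_blockOf_digits n M x]
  congr 1
  funext ν
  simp only [cblk, kfin, koff]
  rw [ZMod.natCast_zmod_val, add_sub_cancel]

/-- the block of a collar site in the chart. [folklore] -/
theorem blockOf_eq_cblk (x : Tor (fine n M)) (hx : x ∈ collar n M w) : blockOf n M x = cblk M w (kfin n M w x hx) := by
  conv_lhs => rw [← csite_kfin n M w x hx]
  rw [csite, blockOf_bpt]

/-- **THE CHART IS INJECTIVE** (`3 ≤ M_ν`: the `3^d` collar blocks are distinct). [folklore] -/
theorem csite_injective (hM3 : ∀ μ, 3 ≤ M μ) :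
    Function.Injective (fun kj : (Fin d → Fin 3) × (Fin d → Fin n) => csite n M w kj.1 kj.2) := by
  rintro ⟨k, j⟩ ⟨k', j'⟩ h
  simp only at h
  have hk : k = k' := by
    funext ν
    apply Fin.ext
    have h1 := koff_csite n M w hM3 k j ν
    have h2 := koff_csite n M w hM3 k' j' ν
    rw [h] at h1
    rw [h1] at h2
    exact h2
  have hj : j = j' := by
    have h1 := digits_csite n M w k j
    have h2 := digits_csite n M w k' j'
    rw [h] at h1
    rw [h1] at h2
    exact h2
  rw [hk, hj]

/-! ## §2 The fold -/

/-- folded digits: identity in the directions with `k_μ = 1`, reversal `j ↦ n − 1 − j` in the others. [folklore] -/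
def foldD (k : Fin d → Fin 3) (j : Fin d → Fin n) : Fin d → Fin n := fun μ => if (k μ : ℕ) = 1 then j μ else Fin.rev (j μ)

/-- **THE FOLD** `F : T → w`: `F x = bpt w (j_μ if koff_μ x = 1, rev j_μ otherwise)` — even reflection of the collar across every face of
`w` (its values off the collar are irrelevant). [folklore] -/
def fold (x : Tor (fine n M)) : Tor (fine n M) :=
  bpt n M w (fun μ => if koff n M w x μ = 1 then digits n M x μ else Fin.rev (digits n M x μ))

/-- the fold of a collar site in the chart. [folklore] -/
theorem fold_csite (hM3 : ∀ μ, 3 ≤ M μ) (k : Fin d → Fin 3) (j : Fin d → Fin n) :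
    fold n M w (csite n M w k j) = bpt n M w (foldD n k j) := by
  simp only [fold, koff_csite n M w hM3, digits_csite]
  rfl

/-- **`F = id` ON `w`** (`2 ≤ M_ν`). [folklore] -/
theorem fold_of_blockOf_eq (hM2 : ∀ μ, 2 ≤ M μ) {x : Tor (fine n M)} (hx : blockOf n M x = w) : fold n M w x = x := by
  simp only [fold, koff_of_blockOf_eq n M w hM2 hx, if_true]
  conv_rhs => rw [← bpt_blockOf_digits n M x, hx]

/-- the fold lands in `w`. [folklore] -/
theorem blockOf_fold (x : Tor (fine n M)) : blockOf n M (fold n M w x) = w := blockOf_bpt n M w _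

omit [NeZero n] in
/-- folded digits are injective in `j` (fixed `k`). [folklore] -/
theorem foldD_injective (k : Fin d → Fin 3) : Function.Injective (foldD n k) := by
  intro j j' h
  funext μ
  have hμ := congrFun h μ
  simp only [foldD] at hμ
  split_ifs at hμ with h1
  · exact hμ
  · exact Fin.rev_injective hμ

/-! ## §3 Unit steps in the chart -/

omit [NeZero n] hM in
/-- `cblk k + e_ρ = cblk (k + 1_ρ)` when `k_ρ + 1 < 3`. [folklore] -/
theorem cblk_add_unitVec (k : Fin d → Fin 3) (ρ : Fin d) (hk : (k ρ : ℕ) + 1 < 3) :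
    cblk M w k + unitVec M ρ = cblk M w (Function.update k ρ ⟨(k ρ : ℕ) + 1, hk⟩) := by
  funext ν
  simp only [cblk, Pi.add_apply, unitVec, Function.update_apply]
  by_cases hν : ν = ρ
  · subst hν
    simp only [if_true, Pi.single_eq_same, Nat.cast_succ]
    ring
  · rw [if_neg hν, Pi.single_eq_of_ne hν, add_zero]

omit [NeZero n] hM in
/-- **STEP INSIDE A COLLAR BLOCK**: `csite k j + e_ρ = csite k j[ρ ↦ j_ρ + 1]` when `j_ρ + 1 < n`. [folklore] -/
theorem csite_add_unitVec_of_lt (k : Fin d → Fin 3) (j : Fin d → Fin n) (ρ : Fin d) (h : (j ρ : ℕ) + 1 < n) :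
    csite n M w k j + unitVec (fine n M) ρ = csite n M w k (Function.update j ρ ⟨(j ρ : ℕ) + 1, h⟩) :=
  bpt_add_unitVec_of_lt n M _ j ρ h

omit hM in
/-- **STEP INTO THE NEXT COLLAR BLOCK**: `csite k j + e_ρ = csite k[ρ ↦ k_ρ+1] j[ρ ↦ 0]` when `j_ρ + 1 = n`, `k_ρ + 1 < 3`. [folklore] -/
theorem csite_add_unitVec_of_eq (k : Fin d → Fin 3) (j : Fin d → Fin n) (ρ : Fin d) (h : (j ρ : ℕ) + 1 = n)
    (hk : (k ρ : ℕ) + 1 < 3) :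
    csite n M w k j + unitVec (fine n M) ρ = csite n M w (Function.update k ρ ⟨(k ρ : ℕ) + 1, hk⟩) (Function.update j ρ 0) := by
  rw [csite, bpt_add_unitVec_of_eq n M _ j ρ h, cblk_add_unitVec M w k ρ hk, csite]

/-- **THE FOLD ALONG AN INTERIOR STEP, identity direction** (`k_ρ = 1`, `j_ρ + 1 < n`): the images are the SAME bond of `w`:
`F(x + e_ρ) = F x + e_ρ`. [folklore] -/
theorem fold_step_id (hM3 : ∀ μ, 3 ≤ M μ) (k : Fin d → Fin 3) (j : Fin d → Fin n) (ρ : Fin d) (h : (j ρ : ℕ) + 1 < n)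
    (hk : (k ρ : ℕ) = 1) :
    fold n M w (csite n M w k j + unitVec (fine n M) ρ) = fold n M w (csite n M w k j) + unitVec (fine n M) ρ := by
  rw [csite_add_unitVec_of_lt n M w k j ρ h, fold_csite n M w hM3, fold_csite n M w hM3]
  have hf : (foldD n k j ρ : ℕ) + 1 < n := by simp only [foldD, hk, if_true]; exact h
  rw [bpt_add_unitVec_of_lt n M w (foldD n k j) ρ hf]
  congr 1
  funext μ
  simp only [foldD, Function.update_apply]
  by_cases hμ : μ = ρ
  · subst hμ; simp only [if_true, hk]
  · simp only [if_neg hμ]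

/-- **THE FOLD ALONG AN INTERIOR STEP, reflected direction** (`k_ρ ≠ 1`, `j_ρ + 1 < n`): the images are the REVERSED bond of `w`:
`F x = F(x + e_ρ) + e_ρ`. [folklore] -/
theorem fold_step_rev (hM3 : ∀ μ, 3 ≤ M μ) (k : Fin d → Fin 3) (j : Fin d → Fin n) (ρ : Fin d) (h : (j ρ : ℕ) + 1 < n)
    (hk : (k ρ : ℕ) ≠ 1) :
    fold n M w (csite n M w k j) = fold n M w (csite n M w k j + unitVec (fine n M) ρ) + unitVec (fine n M) ρ := by
  rw [csite_add_unitVec_of_lt n M w k j ρ h, fold_csite n M w hM3, fold_csite n M w hM3]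
  set j' : Fin d → Fin n := Function.update j ρ ⟨(j ρ : ℕ) + 1, h⟩ with hj'
  have hf : (foldD n k j' ρ : ℕ) + 1 < n := by
    simp only [foldD, if_neg hk, hj', Function.update_self, Fin.val_rev]
    omega
  rw [bpt_add_unitVec_of_lt n M w (foldD n k j') ρ hf]
  congr 1
  funext μ
  simp only [foldD, Function.update_apply, hj']
  by_cases hμ : μ = ρ
  · subst hμ
    simp only [if_true, if_neg hk]
    apply Fin.ext
    simp only [Fin.val_rev]
    omega
  · simp only [if_neg hμ]

/-- **THE FOLD DOES NOT MOVE ACROSS A REFLECTION INTERFACE** (`j_ρ + 1 = n`, `k_ρ ∈ {0, 1}`): `F(x + e_ρ) = F x`. [folklore] -/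
theorem fold_cross (hM3 : ∀ μ, 3 ≤ M μ) (k : Fin d → Fin 3) (j : Fin d → Fin n) (ρ : Fin d) (h : (j ρ : ℕ) + 1 = n)
    (hk : (k ρ : ℕ) + 1 < 3) :
    fold n M w (csite n M w k j + unitVec (fine n M) ρ) = fold n M w (csite n M w k j) := by
  rw [csite_add_unitVec_of_eq n M w k j ρ h hk, fold_csite n M w hM3, fold_csite n M w hM3]
  congr 1
  funext μ
  simp only [foldD, Function.update_apply]
  by_cases hμ : μ = ρ
  · subst hμ
    simp only [if_true]
    have hk2 : (k μ : ℕ) = 0 ∨ (k μ : ℕ) = 1 := by omega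
    rcases hk2 with h0 | h1
    · -- entering `w` from below: `rev (n-1) = 0`
      rw [if_pos (by simp [h0]), if_neg (by simp [h0])]
      apply Fin.ext; simp only [Fin.val_rev, Fin.val_zero]; omega
    · -- leaving `w` upward: `rev 0 = n - 1`
      rw [if_neg (by simp [h1]), if_pos h1]
      apply Fin.ext; simp only [Fin.val_rev, Fin.val_zero]; omega
  · simp only [if_neg hμ]

/-- the `ρ`-digit after crossing is `0` and the other digits are unchanged (any block). [folklore] -/
theorem digits_add_unitVec_of_eq (x : Tor (fine n M)) (ρ : Fin d) (h : (digits n M x ρ : ℕ) + 1 = n) :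
    digits n M (x + unitVec (fine n M) ρ) = Function.update (digits n M x) ρ 0 := by
  conv_lhs => rw [← bpt_blockOf_digits n M x, bpt_add_unitVec_of_eq n M _ _ ρ h, digits_bpt]

/-- … and inside a block the `ρ`-digit goes up by one. [folklore] -/
theorem digits_add_unitVec_of_lt (x : Tor (fine n M)) (ρ : Fin d) (h : (digits n M x ρ : ℕ) + 1 < n) :
    digits n M (x + unitVec (fine n M) ρ) = Function.update (digits n M x) ρ ⟨(digits n M x ρ : ℕ) + 1, h⟩ := by
  conv_lhs => rw [← bpt_blockOf_digits n M x, bpt_add_unitVec_of_lt n M _ _ ρ h, digits_bpt]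

/-- offsets in the directions `ν ≠ ρ` do not change under a `ρ`-step. [folklore] -/
theorem koff_add_unitVec_of_ne (x : Tor (fine n M)) {ρ ν : Fin d} (hν : ν ≠ ρ) :
    koff n M w (x + unitVec (fine n M) ρ) ν = koff n M w x ν := by
  rw [koff, koff]
  rcases blockOf_add_unitVec n M x ρ with h1 | h2
  · rw [h1]
  · rw [h2, Pi.add_apply, unitVec, Pi.single_eq_of_ne hν, add_zero]

/-- inside a block no offset changes. [folklore] -/
theorem koff_add_unitVec_of_lt (x : Tor (fine n M)) (ρ : Fin d) (h : (digits n M x ρ : ℕ) + 1 < n) (ν : Fin d) :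
    koff n M w (x + unitVec (fine n M) ρ) ν = koff n M w x ν := by
  rw [koff, koff]
  conv_lhs => rw [← bpt_blockOf_digits n M x, bpt_add_unitVec_of_lt n M _ _ ρ h, blockOf_bpt]

/-- **CROSSING A BLOCK FACE CHANGES THE `ρ`-OFFSET BY ONE, OR WRAPS IT TO `0`** (`2 ≤ M_ρ`). [folklore] -/
theorem koff_add_unitVec_of_eq (hM2 : ∀ μ, 2 ≤ M μ) (x : Tor (fine n M)) (ρ : Fin d) (h : (digits n M x ρ : ℕ) + 1 = n) :
    koff n M w (x + unitVec (fine n M) ρ) ρ = koff n M w x ρ + 1 ∨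
      (koff n M w (x + unitVec (fine n M) ρ) ρ = 0 ∧ koff n M w x ρ + 1 = M ρ) := by
  haveI : Fact (1 < M ρ) := ⟨hM2 ρ⟩
  have hb : blockOf n M (x + unitVec (fine n M) ρ) = blockOf n M x + unitVec M ρ := by
    conv_lhs => rw [← bpt_blockOf_digits n M x, bpt_add_unitVec_of_eq n M _ _ ρ h, blockOf_bpt]
  have hz : blockOf n M (x + unitVec (fine n M) ρ) ρ - (w ρ - 1) = (blockOf n M x ρ - (w ρ - 1)) + 1 := by
    rw [hb, Pi.add_apply, unitVec, Pi.single_eq_same]; ring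
  rw [koff, koff, hz, ZMod.val_add, ZMod.val_one]
  set z := (blockOf n M x ρ - (w ρ - 1)).val
  have hzlt : z < M ρ := ZMod.val_lt _
  by_cases hlt : z + 1 < M ρ
  · left; exact Nat.mod_eq_of_lt hlt
  · right
    have heq : z + 1 = M ρ := by omega
    exact ⟨by rw [heq, Nat.mod_self], heq⟩

end Summit.QuantumFields.BalabanUV.T4Continuum.RegionCollarFold

end
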